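import Literature.Computability.Complexity.Williams2014StageAFP
import Literature.Computability.Complexity.UniversalWitnessCircuitsTwoLeaves
import Literature.Computability.Complexity.EasyWitnessProofs
import HarnessLib

/-!
# Williams' transfer theorem for `ACC` (Thm. 1.3): the remaining leaves after Lemma 3.1 / Thm. 3.2

R. Williams, *Nonuniform ACC circuit lower bounds*, J. ACM 61 (2014), Thm. 1.3 (for `ACC`, the
named fact `Williams2014_lowerBound_of_accSat` of `Williams2014.lean`). With Lemma 3.1 and
Thm. 3.2 now theorems of the tree (`Williams2014_lemma_3_1_holds`, `Williams2014_thm_3_2_holds`,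
`Williams2014StageAFP.lean`), the nondeterministic time hierarchy theorem
(`Diag.ntime_hierarchy_holds`), IKW's Lemma 5 and Thm. 2 and `EXP ⊆ P/poly ⟹ EXP = MA`
(`EXP_eq_MA_of_subset_PPoly_holds`, `EasyWitnessProofs.lean`) as well, this file records the
current frontier of the transfer theorem as proved implications (no new named fact):

* `Williams2014_thm_5_2_of_williams2010`: Thm. 5.2 (succinct witnesses under `NEXP ⊆ P/poly`)
  from the single remaining easy-witness leaf `Williams2010_MA_io_of_not_witnessCircuits`
  (Williams 2010, App. A), by `Williams2014_thm_5_2_of_two_leaves`;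
* `Williams2014_lowerBound_of_accSat_of_frontier`: Thm. 1.3 for `ACC` from exactly two named
  facts — Fact 3.1 (`Williams2014_fact_3_1`, the quasi-linear succinct Cook–Levin reduction) and
  `Williams2010_MA_io_of_not_witnessCircuits` — so that its discharge is the one-liner
  `Williams2014_lowerBound_of_accSat_of_frontier Williams2014_fact_3_1_holds
  Williams2010_MA_io_of_not_witnessCircuits_holds` once those two land.

## References

* R. Williams, *Nonuniform ACC circuit lower bounds*, J. ACM 61 (2014) 2:1–2:32, Thm. 1.3 and the
  proof of Thm. 1.1 (pp. 17–18), Fact 3.1, Lemma 3.1, Thm. 3.2, Thm. 5.2 [Williams2014].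
* R. Williams, *Improving exhaustive search implies superpolynomial lower bounds*, STOC 2010,
  Appendix A [Williams2010STOC].
-/

namespace Literature.Computability.Complexity

/-- **Williams 2014, Thm. 5.2 from its last leaf**: with `EXP ⊆ P/poly ⟹ EXP = MA` a theorem of
the tree, Thm. 5.2 follows from the infinitely-often simulation of `MA` from a verifier without
witness circuits (`Williams2010_MA_io_of_not_witnessCircuits`).
[cite: Williams2014, Thm. 5.2] -/
theorem Williams2014_thm_5_2_of_williams2010 (hA : Williams2010_MA_io_of_not_witnessCircuits) :
    Williams2014_thm_5_2 :=
  Williams2014_thm_5_2_of_two_leaves EXP_eq_MA_of_subset_PPoly_holds hA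

/-- **Williams 2014, Thm. 1.3 for `ACC` from its two remaining leaves**: Fact 3.1
(`Williams2014_fact_3_1`) and `Williams2010_MA_io_of_not_witnessCircuits`; Lemma 3.1, Thm. 3.2
(machine `B`), Thm. 5.2's other ingredients and the nondeterministic time hierarchy theorem are
theorems of the tree. [cite: Williams2014, Thm. 1.3 (proof)] -/
theorem Williams2014_lowerBound_of_accSat_of_frontier (h31 : Williams2014_fact_3_1)
    (hA : Williams2010_MA_io_of_not_witnessCircuits) : Williams2014_lowerBound_of_accSat :=
  Williams2014_lowerBound_of_accSat_of_two h31 (Williams2014_thm_5_2_of_williams2010 hA)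

end Literature.Computability.Complexity
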